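import Mathlib
import Literature.MathematicalPhysics.QuantumFieldTheory.Balaban1983to89.T3UnitLawDensityEML
import HarnessLib

/-!
# Route `SpecificationCompactness`, LINE 15 «cocycle_limit» (crux `SpecificationLimitAE`, stmt-QuantumFields-22688) — STUB D
# `stub_unitDensityPosAE` REDUCED TO REVERSE ABSOLUTE CONTINUITY of Bałaban's one-step averaging

The planner's sizing of stub D (STUB-PLAN-B-D.md, ym-idea-5 g10): «ρ̂_K > 0 π₀-a.e. ⇔ reverse absolute continuity
`fieldMeasure (j+1) ≪ (fieldMeasure j).map (avgFun expMeanLogSU)` at every level of the standing range — the tree has only the forward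
direction `HaarAC`».  THIS FILE proves the «⇐» as a theorem (`unitDensity_pos_ae_of_reverseAC`): the renormalised densities are
`ρ₀ = e^{−β_K A} > 0` and `ρ_{k+1} = rnTransport (avg_k) ρ_k` = the Radon–Nikodym derivative of `(avg_k)_*(ρ_k dU)` with respect to `dV`
(`AveragingRT.rnDensity`); if `ρ_k > 0` a.e. then `ρ_k dU ~ dU`, so `(avg_k)_*(ρ_k dU) ≫ (avg_k)_* dU ≫ dV` under REVERSE HAAR-AC, and a
Radon–Nikodym derivative of a measure dominating `dV` is `dV`-a.e. positive (Mathlib `Measure.rnDeriv_pos'`) and a.e. finite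
(`Measure.rnDeriv_lt_top`); the unit density is `ρ_K` read through the measure-preserving level identification `fieldShift`.
So stub D = exactly the geometric reverse-a.c. hypothesis of `unitDensity_pos_ae_of_reverseAC` below (every coarse configuration set of positive product-Haar measure
has an averaging preimage of positive measure); its natural proof is the «all guards fail» event of the STUB-PLAN (open, of positive
measure in the off-central variables, on which `Ū(c) = pre_c · g_c · post_c` is a Haar translate of the independent central bond `g_c`).
Cell `ym-idea-1` width seat `ym-line-sfw-p2-w3` gen 27 (free hands).  HONEST FRAMING: measure theory only; rung R3 RECORD line; no crux, route,
rung or mass gap is proved.  Sources: [Balaban1985UV3] (1)–(2) p. 256 (the densities); [Balaban1987RG1] (0.13) p. 254.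
-/

noncomputable section

namespace Summit.QuantumFields.YangMills.Theorems.SpecificationCompactnessUnitDensityPosOfReverseAC

open MeasureTheory Filter Function Set
open Literature.MathematicalPhysics.QuantumFieldTheory.Balaban1983to89
open Literature.MathematicalPhysics.QuantumFieldTheory.Balaban1983to89.T3ContinuumYM3Torus
open Literature.MathematicalPhysics.QuantumFieldTheory.Balaban1983to89.T3UnitLawDensityEML
open Literature.MathematicalPhysics.QuantumFieldTheory.Balaban1983to89.T3LevelShift
open Literature.MathematicalPhysics.QuantumFieldTheory.Balaban1983to89.Missing

/-! ## §1 Generic: the Radon–Nikodym transport of an a.e.-positive density over a reverse-a.c. map is a.e. positive -/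

section Generic

variable {P : Params} {j : ℕ} {G : Type*} [GaugeGroup G] [MeasurableSpace G] [HaarData G]

/-- **RN TRANSPORT OF AN a.e.-POSITIVE DENSITY IS a.e. POSITIVE UNDER REVERSE A.C.**: if `ρ ≥ 0` is measurable with `ρ > 0` `dU`-a.e.,
`avg` is measurable and `dV ≪ avg_* dU` (reverse Haar-a.c.), then `rnDensity avg ρ > 0` `dV`-a.e. [cite: Balaban1987RG1, (0.13) p.254] -/
theorem rnDensity_pos_ae {avg : GaugeField P j G → GaugeField P (j+1) G} (havg : Measurable avg)
    {ρ : GaugeField P j G → ℝ} (hρm : Measurable ρ) (hρpos : ∀ᵐ U ∂(fieldMeasure P j G), 0 < ρ U)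
    (hρi : Integrable ρ (fieldMeasure P j G))
    (hrev : fieldMeasure P (j+1) G ≪ (fieldMeasure P j G).map avg) :
    ∀ᵐ V ∂(fieldMeasure P (j+1) G), 0 < AveragingRT.rnDensity avg ρ V := by
  -- `ρ dU ≫ dU` because `ρ > 0` a.e.
  have hac1 : fieldMeasure P j G ≪ (fieldMeasure P j G).withDensity (fun U => ENNReal.ofReal (ρ U)) := by
    refine (withDensity_absolutelyContinuous' hρm.ennreal_ofReal.aemeasurable ?_)
    filter_upwards [hρpos] with U hU
    exact (ENNReal.ofReal_pos.mpr hU).ne'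
  -- hence `dV ≪ avg_*(ρ dU) = pushDensity`
  have hac2 : fieldMeasure P (j+1) G ≪ AveragingRT.pushDensity avg ρ :=
    hrev.trans (hac1.map havg)
  haveI : IsFiniteMeasure (AveragingRT.pushDensity avg ρ) := by
    unfold AveragingRT.pushDensity
    haveI : IsFiniteMeasure ((fieldMeasure P j G).withDensity fun U => ENNReal.ofReal (ρ U)) :=
      isFiniteMeasure_withDensity_ofReal hρi.2
    exact Measure.isFiniteMeasure_map _ _
  have hpos := Measure.rnDeriv_pos' (ν := AveragingRT.pushDensity avg ρ) (μ := fieldMeasure P (j+1) G) hac2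
  have hlt := Measure.rnDeriv_lt_top (AveragingRT.pushDensity avg ρ) (fieldMeasure P (j+1) G)
  filter_upwards [hpos, hlt] with V h1 h2
  exact ENNReal.toReal_pos h1.ne' h2.ne

end Generic

/-! ## §2 The renormalised unit density of the `K`-th approximation -/

section YM

/-- **THE RENORMALISED DENSITIES ARE a.e. POSITIVE UNDER REVERSE HAAR-A.C.**: `ρ_k > 0` `dV_k`-a.e. for every `k ≤ n ≤ m + K`.
[cite: Balaban1985UV3, (1)-(2) p.256] -/
theorem emlDensity_pos_ae (F : T3Family) {γ : ℝ} (hγ : 0 ≤ γ) (K n : ℕ) (hn : n ≤ F.m + K)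
    (hrev : ∀ j : ℕ, j < n →
      fieldMeasure (F.P K) (j + 1) (Matrix.specialUnitaryGroup (Fin 2) ℂ) ≪
        (fieldMeasure (F.P K) j (Matrix.specialUnitaryGroup (Fin 2) ℂ)).map
          (BlockAveraging.blockAvg (P := F.P K) (j := j) ℰp).avg) :
    ∀ k : ℕ, k ≤ n → ∀ᵐ V ∂(fieldMeasure (F.P K) k (Matrix.specialUnitaryGroup (Fin 2) ℂ)), 0 < emlDensity F γ K k V := by
  intro k
  induction k with
  | zero => intro _; exact ae_of_all _ fun V => by rw [emlDensity_zero]; exact boltzmann_pos _ _ V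
  | succ k ih =>
    intro hk
    have hk' : k + 1 ≤ F.m + K := hk.trans hn
    have hprev := ih (Nat.le_of_succ_le hk)
    rw [emlDensity_succ F γ K hk']
    -- `ρ_{k+1} = rnTransport = rnDensity` (non-negative density)
    have h0 := emlDensity_nonneg F γ K k
    have heq : ∀ V, (rt F K k hk').T (emlDensity F γ K k) V =
        AveragingRT.rnDensity (BlockAveraging.blockAvg (P := F.P K) (j := k) ℰp).avg (emlDensity F γ K k) V := by
      intro V
      show AveragingRT.rnTransport _ _ V = _
      simp only [AveragingRT.rnTransport, if_pos h0]
    simp_rw [heq]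
    exact rnDensity_pos_ae (measurable_blockAvg F K k) (measurable_emlDensity F γ K k) hprev
      (integrable_emlDensity F K hγ k (by omega)) (hrev k (by omega))

/-- **STUB D REDUCED TO REVERSE HAAR-A.C.**: if the (0.4) averagings of the `K`-th approximation are reverse Haar-absolutely continuous at
every level `j < K` (reverse Haar-a.c.: `dV_{j+1} ≪ (avg_j)_* dU_j`), then Bałaban's renormalised unit density is `π₀`-a.e. positive,
`unitDensity F γ K > 0` a.e. (`γ ≥ 0`). [cite: Balaban1985UV3, (2) p.256] -/
theorem unitDensity_pos_ae_of_reverseAC (F : T3Family) {γ : ℝ} (hγ : 0 ≤ γ) (K : ℕ)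
    (hrev : ∀ j : ℕ, j < K →
      fieldMeasure (F.P K) (j + 1) (Matrix.specialUnitaryGroup (Fin 2) ℂ) ≪
        (fieldMeasure (F.P K) j (Matrix.specialUnitaryGroup (Fin 2) ℂ)).map
          (BlockAveraging.blockAvg (P := F.P K) (j := j) ℰp).avg) :
    ∀ᵐ V ∂(fieldMeasure (F.P 0) 0 (Matrix.specialUnitaryGroup (Fin 2) ℂ)), 0 < unitDensity F γ K V := by
  have h := emlDensity_pos_ae F hγ K K (Nat.le_add_left K F.m) hrev K le_rfl
  have hmp := measurePreserving_fieldShift (G := Matrix.specialUnitaryGroup (Fin 2) ℂ) (F.sitesPerDir_unit K).symm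
  exact hmp.quasiMeasurePreserving.ae h

end YM

end Summit.QuantumFields.YangMills.Theorems.SpecificationCompactnessUnitDensityPosOfReverseAC

end
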